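import Mathlib
import HarnessLib
import Literature.Computability.Complexity.ACFourierTails
import Literature.Computability.Complexity.ConstantDepth

/-!
# PneNP / OverlapGapAlgebra — `SearchHardWindow`, Line A rung: Fourier tails of AC⁰ circuits, asymptotic form

Support for crux `stmt-PneNP-2460` (`Summit.PneNP.PneNP.Theses.OverlapGapAlgebra.SearchHardWindow`),
line Sketch / Line A (approx-degree ladder), stub `stub_acTailBound`.

Tal's theorem (Tal 2017, Thm. 3.6 / 3.8), held in the tree as
`Literature.Computability.Complexity.ACForm.tailWeight_le_tailBound` together with
`Literature.Computability.Complexity.Circuit.exists_acForm`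
(file `Literature/Computability/Complexity/ACFourierTails.lean`), in asymptotic dress: for fixed
depth `d` and size exponent `c` there is a level sequence `D n = O((log n)^{d+1}) = o(n)` with
`D n ≥ 1` such that, for all large `n` (in fact all `n ≥ 1`), every circuit over `acBasis` of
`acDepth ≤ d` and size `≤ n^c` — on any number `N` of inputs — has Fourier tail
`W^{≥ D n}[sgn ∘ C] ≤ n^{-3}`.

Choice of the level. The circuit is a layered formula of height `≤ d + 1 ≤ d + 2`, bottom fan-in
`1` and effective size `≤ 2 n^c =: M` (`Circuit.exists_acForm`); with `ℓ = logM M = ⌊log₂(M+1)⌋`,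
`t = 1` and height parameter `d + 2`, Tal's bound at level `k` is
`8^{d+2} · 2^{-k/(B^{d+2} ℓ^d)}` (`B = cB = 16896`). Taking
`k = D' n = B^{d+2} ℓ^d E`, `E = 3(⌊log₂ n⌋ + 1) + 3(d + 2)`, makes it exactly
`8^{d+2} 2^{-E} ≤ n^{-3}` (as `n < 2^{⌊log₂ n⌋+1}`), and the level
`D n = D' n + 1 = B^{d+2} ⌊log₂(2n^c+1)⌋^d (3(⌊log₂ n⌋ + 1) + 3(d + 2)) + 1` is `≥ 1` everywhere and
`O((log n)^{d+1}) = o(n)` (`Real.isLittleO_pow_log_id_atTop`). No new definitions: the level is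
written out in each statement.

Axioms: `propext`, `Classical.choice`, `Quot.sound`.
-/

-- `Summit.PneNP.PneNP.…` is the tree's mandated namespace (summit = sub-problem name).
set_option linter.dupNamespace false

noncomputable section

namespace Summit.PneNP.PneNP.Theorems

open Finset Filter Asymptotics Literature.Computability.Complexity Literature.Computability.Complexity.LowDegree
open Literature.Probability.RandomGraphs.LowDegree (sgn walsh)
open scoped Classical

/-! ### The exponent and Tal's bound at the chosen level -/

/-- `8^{d+2} · n³ ≤ 2^E` for `E = 3(⌊log₂ n⌋ + 1) + 3(d + 2)`, from `n < 2^{⌊log₂ n⌋ + 1}`. [folklore] -/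
theorem shwACTail_eight_pow_mul_cube_le (d n : ℕ) :
    8 ^ (d + 2) * n ^ 3 ≤ 2 ^ (3 * (Nat.log 2 n + 1) + 3 * (d + 2)) := by
  have hn : n < 2 ^ (Nat.log 2 n + 1) := Nat.lt_pow_succ_log_self one_lt_two n
  have h3 : n ^ 3 ≤ (2 ^ (Nat.log 2 n + 1)) ^ 3 := Nat.pow_le_pow_left hn.le 3
  have h8 : (2 : ℕ) ^ (3 * (d + 2)) = 8 ^ (d + 2) := by rw [pow_mul]; norm_num
  have hL : (2 : ℕ) ^ (3 * (Nat.log 2 n + 1)) = (2 ^ (Nat.log 2 n + 1)) ^ 3 := by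
    rw [← pow_mul, mul_comm]
  rw [pow_add 2 (3 * (Nat.log 2 n + 1)) (3 * (d + 2)), h8, hL]
  calc 8 ^ (d + 2) * n ^ 3 ≤ 8 ^ (d + 2) * (2 ^ (Nat.log 2 n + 1)) ^ 3 := Nat.mul_le_mul_left _ h3
    _ = (2 ^ (Nat.log 2 n + 1)) ^ 3 * 8 ^ (d + 2) := mul_comm _ _

/-- With `t = 1`, height parameter `d + 2` and level `k = B^{d+2} ℓ^d E`, Tal's bound
`tailBound ℓ (d+2) 1 k` equals `8^{d+2} · 2^{-E}`, hence is `≤ n^{-3}` as soon as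
`8^{d+2} n³ ≤ 2^E` (`ℓ, n ≥ 1`). [folklore] -/
theorem shwACTail_tailBound_le {d n ℓ E : ℕ} (hℓ : 1 ≤ ℓ) (hn : 1 ≤ n)
    (hE : 8 ^ (d + 2) * n ^ 3 ≤ 2 ^ E) :
    ACForm.tailBound ℓ (d + 2) 1 (ACForm.cB ^ (d + 2) * ℓ ^ d * E) ≤ 1 / (n : ℝ) ^ 3 := by
  have hℓpos : (0 : ℝ) < ℓ := by exact_mod_cast hℓ
  have hnpos : (0 : ℝ) < n := by exact_mod_cast hn
  have hB : (0 : ℝ) < (ACForm.cB : ℝ) := by unfold ACForm.cB ACForm.B0; norm_num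
  have hT : (0 : ℝ) < (ACForm.cB : ℝ) ^ (d + 2) * ((1 : ℕ) : ℝ) * (ℓ : ℝ) ^ (d + 2 - 2) := by
    rw [Nat.cast_one]; positivity
  have hexp : ((ACForm.cB ^ (d + 2) * ℓ ^ d * E : ℕ) : ℝ) * Real.log 2 /
      ((ACForm.cB : ℝ) ^ (d + 2) * ((1 : ℕ) : ℝ) * (ℓ : ℝ) ^ (d + 2 - 2)) = (E : ℝ) * Real.log 2 := by
    rw [div_eq_iff hT.ne', show d + 2 - 2 = d from by omega]
    push_cast
    ring
  have hA : ((ACForm.cA : ℕ) : ℝ) = 8 := by unfold ACForm.cA; norm_num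
  have key : (8 : ℝ) ^ (d + 2) * (n : ℝ) ^ 3 ≤ (2 : ℝ) ^ E := by exact_mod_cast hE
  unfold ACForm.tailBound
  rw [hexp, Real.exp_neg, Real.exp_nat_mul, Real.exp_log two_pos, hA, ← div_eq_mul_inv,
    div_le_div_iff₀ (by positivity) (by positivity), one_mul]
  exact key

/-! ### The tail bound at the level `D n`, uniformly in the number of inputs -/

/-- **Tal's theorem, uniform in the number of inputs**: for `n ≥ 1`, every circuit over `acBasis` of
`acDepth ≤ d` and size `≤ n^c` on `N` inputs has `W^{≥ D n}[sgn ∘ C] ≤ n^{-3}` at the level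
`D n = B^{d+2} ⌊log₂(2n^c+1)⌋^d (3(⌊log₂ n⌋ + 1) + 3(d + 2)) + 1`
(`Circuit.exists_acForm` + `ACForm.tailWeight_le_tailBound` with `M = 2n^c`, `t = 1`, height `d + 2`,
and antitonicity of the tail in the level for the final `+ 1`). [cite: Tal2017, Theorem 3.6] -/
theorem shwACTail_tailWeight_le (d c : ℕ) {n : ℕ} (hn : 1 ≤ n) (N : ℕ) (C : Circuit (Fin N))
    (hC : C.IsOver acBasis) (hd : C.acDepth ≤ d) (hs : C.size ≤ n ^ c) :
    tailWeight (fun x => sgn (C.eval x))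
        (ACForm.cB ^ (d + 2) * ACForm.logM (2 * n ^ c) ^ d * (3 * (Nat.log 2 n + 1) + 3 * (d + 2)) + 1) ≤
      1 / (n : ℝ) ^ 3 := by
  obtain ⟨f, hev, hh, hw, hsize⟩ := C.exists_acForm hC
  have hfun : (fun x => sgn (C.eval x)) = ACForm.sgnEval f := by
    funext x; rw [ACForm.sgnEval, hev]
  rw [hfun]
  have hM : 1 ≤ 2 * n ^ c := by have := Nat.one_le_pow c n hn; omega
  have hℓ1 : 1 ≤ ACForm.logM (2 * n ^ c) := ACForm.one_le_logM hM
  have hheight : f.height ≤ d + 2 := by omega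
  have hesize : f.esize ≤ 2 * n ^ c := by omega
  have main := ACForm.tailWeight_le_tailBound hM (d + 2) (by omega) f 1 le_rfl hℓ1 hheight hesize hw
    (ACForm.cB ^ (d + 2) * ACForm.logM (2 * n ^ c) ^ d * (3 * (Nat.log 2 n + 1) + 3 * (d + 2)))
  calc tailWeight (ACForm.sgnEval f)
        (ACForm.cB ^ (d + 2) * ACForm.logM (2 * n ^ c) ^ d * (3 * (Nat.log 2 n + 1) + 3 * (d + 2)) + 1)
      ≤ tailWeight (ACForm.sgnEval f)
          (ACForm.cB ^ (d + 2) * ACForm.logM (2 * n ^ c) ^ d * (3 * (Nat.log 2 n + 1) + 3 * (d + 2))) :=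
        tailWeight_antitone _ (Nat.le_succ _)
    _ ≤ ACForm.tailBound (ACForm.logM (2 * n ^ c)) (d + 2) 1
          (ACForm.cB ^ (d + 2) * ACForm.logM (2 * n ^ c) ^ d * (3 * (Nat.log 2 n + 1) + 3 * (d + 2))) :=
        main
    _ ≤ 1 / (n : ℝ) ^ 3 := shwACTail_tailBound_le hℓ1 hn (shwACTail_eight_pow_mul_cube_le d n)

/-! ### The level is `o(n)` -/

/-- `ℓ = ⌊log₂(2n^c + 1)⌋ ≤ (c + 2) log n / log 2` for `n ≥ 2` (`2n^c + 1 ≤ n^{c+2}`). [folklore] -/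
theorem shwACTail_logM_le (c : ℕ) {n : ℕ} (hn : 2 ≤ n) :
    ((ACForm.logM (2 * n ^ c) : ℕ) : ℝ) ≤ (c + 2 : ℝ) / Real.log 2 * Real.log n := by
  have hlog2 : 0 < Real.log 2 := Real.log_pos one_lt_two
  have hn' : (2 : ℝ) ≤ n := by exact_mod_cast hn
  have h := Real.natLog_le_logb (2 * n ^ c + 1) 2
  rw [Real.logb] at h
  push_cast at h
  unfold ACForm.logM
  refine h.trans ?_
  rw [div_mul_eq_mul_div, div_le_div_iff_of_pos_right hlog2]
  have h1 : (1 : ℝ) ≤ (n : ℝ) ^ c := one_le_pow₀ (by linarith)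
  have h3 : (2 : ℝ) * (n : ℝ) ^ c + 1 ≤ (n : ℝ) ^ (c + 2) := by
    have h4 : (4 : ℝ) ≤ (n : ℝ) ^ 2 := by nlinarith
    calc (2 : ℝ) * (n : ℝ) ^ c + 1 ≤ 4 * (n : ℝ) ^ c := by linarith
      _ ≤ (n : ℝ) ^ 2 * (n : ℝ) ^ c := by gcongr
      _ = (n : ℝ) ^ (c + 2) := by ring
  calc Real.log (2 * (n : ℝ) ^ c + 1) ≤ Real.log ((n : ℝ) ^ (c + 2)) :=
        Real.log_le_log (by positivity) h3
    _ = (c + 2 : ℝ) * Real.log n := by rw [Real.log_pow]; push_cast; ring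

/-- `E = 3(⌊log₂ n⌋ + 1) + 3(d + 2) ≤ (3d + 12) log n / log 2` for `n ≥ 2`. [folklore] -/
theorem shwACTail_exp_le (d : ℕ) {n : ℕ} (hn : 2 ≤ n) :
    ((3 * (Nat.log 2 n + 1) + 3 * (d + 2) : ℕ) : ℝ) ≤ (3 * d + 12 : ℝ) / Real.log 2 * Real.log n := by
  have hlog2 : 0 < Real.log 2 := Real.log_pos one_lt_two
  have hn' : (2 : ℝ) ≤ n := by exact_mod_cast hn
  have hlogn : Real.log 2 ≤ Real.log n := Real.log_le_log two_pos hn'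
  have h := Real.natLog_le_logb n 2
  rw [Real.logb] at h
  push_cast at h
  have h1 : (1 : ℝ) ≤ Real.log n / Real.log 2 := by rw [le_div_iff₀ hlog2, one_mul]; exact hlogn
  have hd0 : (0 : ℝ) ≤ 3 * ((d : ℝ) + 2) := by positivity
  have h2 := mul_le_mul_of_nonneg_left h1 hd0
  push_cast
  calc (3 : ℝ) * ((Nat.log 2 n : ℝ) + 1) + 3 * ((d : ℝ) + 2)
      ≤ 3 * (Real.log n / Real.log 2 + Real.log n / Real.log 2) +
          3 * ((d : ℝ) + 2) * (Real.log n / Real.log 2) := by linarith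
    _ = (3 * d + 12 : ℝ) / Real.log 2 * Real.log n := by ring

/-- The level `D n = B^{d+2} ⌊log₂(2n^c+1)⌋^d (3(⌊log₂ n⌋ + 1) + 3(d + 2)) + 1` is
`O((log n)^{d+1}) = o(n)`. [folklore] -/
theorem shwACTail_level_isLittleO (d c : ℕ) :
    (fun n : ℕ => ((ACForm.cB ^ (d + 2) * ACForm.logM (2 * n ^ c) ^ d *
        (3 * (Nat.log 2 n + 1) + 3 * (d + 2)) + 1 : ℕ) : ℝ)) =o[atTop] (fun n : ℕ => (n : ℝ)) := by
  -- `(log n)^(d+1) = o(n)` along the naturals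
  have h1 : (fun n : ℕ => Real.log (n : ℝ) ^ (d + 1)) =o[atTop] (fun n : ℕ => (n : ℝ)) :=
    Real.isLittleO_pow_log_id_atTop.comp_tendsto tendsto_natCast_atTop_atTop
  -- `D' n ≤ K (log n)^(d+1)` for `n ≥ 2`
  set K : ℝ := (ACForm.cB : ℝ) ^ (d + 2) * ((c + 2 : ℝ) / Real.log 2) ^ d *
    ((3 * d + 12 : ℝ) / Real.log 2) with hK
  have h2 : (fun n : ℕ => ((ACForm.cB ^ (d + 2) * ACForm.logM (2 * n ^ c) ^ d *
      (3 * (Nat.log 2 n + 1) + 3 * (d + 2)) : ℕ) : ℝ)) =O[atTop] (fun n : ℕ => Real.log (n : ℝ) ^ (d + 1)) := by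
    refine IsBigO.of_bound K (eventually_atTop.2 ⟨2, fun n hn => ?_⟩)
    have hℓ := shwACTail_logM_le c hn
    have hE := shwACTail_exp_le d hn
    have hlogn0 : 0 ≤ Real.log (n : ℝ) := Real.log_natCast_nonneg n
    rw [Real.norm_natCast, Real.norm_of_nonneg (pow_nonneg hlogn0 _)]
    push_cast at hE ⊢
    calc (ACForm.cB : ℝ) ^ (d + 2) * ((ACForm.logM (2 * n ^ c) : ℕ) : ℝ) ^ d *
          (3 * ((Nat.log 2 n : ℝ) + 1) + 3 * ((d : ℝ) + 2))
        ≤ (ACForm.cB : ℝ) ^ (d + 2) * ((c + 2 : ℝ) / Real.log 2 * Real.log n) ^ d *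
            ((3 * d + 12 : ℝ) / Real.log 2 * Real.log n) := by gcongr
      _ = K * Real.log n ^ (d + 1) := by
          rw [hK, mul_pow ((c + 2 : ℝ) / Real.log 2) (Real.log n) d]; ring
  have h3 := h2.trans_isLittleO h1
  have h4 : (fun _ : ℕ => (1 : ℝ)) =o[atTop] (fun n : ℕ => (n : ℝ)) :=
    isLittleO_const_left.2 (Or.inr
      (tendsto_natCast_atTop_atTop.congr fun n => (Real.norm_natCast n).symm))
  refine (h3.add h4).congr_left fun n => ?_
  push_cast
  ring

/-! ### Assembly -/

/-- **Stub `stub_acTailBound` of crux `stmt-PneNP-2460` (line Sketch / Line A rung): Tal's Fourier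
tail bound for AC⁰ in asymptotic form.** For every depth `d` and size exponent `c` there is a level
sequence `D n = o(n)`, `D n ≥ 1`, such that eventually every circuit over `acBasis` of
`acDepth ≤ d` and size `≤ n^c` (on any number of inputs) has `W^{≥ D n}[sgn ∘ C] ≤ 1/n³`; here
`D n = B^{d+2} ⌊log₂(2n^c+1)⌋^d (3(⌊log₂ n⌋ + 1) + 3(d + 2)) + 1`, `B = 16896`, and the bound holds
for all `n ≥ 1`. [cite: Tal2017, Theorem 3.6] -/
theorem stub_acTailBound (d c : ℕ) :
    ∃ D : ℕ → ℕ, (fun n : ℕ => (D n : ℝ)) =o[atTop] (fun n : ℕ => (n : ℝ)) ∧ (∀ n, 1 ≤ D n) ∧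
      ∀ᶠ n : ℕ in atTop, ∀ (N : ℕ) (C : Circuit (Fin N)),
        C.IsOver acBasis → C.acDepth ≤ d → C.size ≤ n ^ c →
          tailWeight (fun x => sgn (C.eval x)) (D n) ≤ 1 / (n : ℝ) ^ 3 :=
  ⟨fun n => ACForm.cB ^ (d + 2) * ACForm.logM (2 * n ^ c) ^ d * (3 * (Nat.log 2 n + 1) + 3 * (d + 2)) + 1,
    shwACTail_level_isLittleO d c, fun _ => Nat.le_add_left 1 _,
    eventually_atTop.2 ⟨1, fun _ hn N C hC hd hs => shwACTail_tailWeight_le d c hn N C hC hd hs⟩⟩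

end Summit.PneNP.PneNP.Theorems

end
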